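import Summits.ResolutionOfSingularities.ResolutionOfSingularities.Theorems.PurelyInseparableDim4ShadeTwoSwapStep
import Summits.ResolutionOfSingularities.ResolutionOfSingularities.Theorems.PurelyInseparableDim4SwapTransport
import HarnessLib
import HarnessLib.Audit.Tags

/-!
# Purely inseparable four-folds — K2(p), PHASE `d = 2`, PART XIV: NO ISOLATED SHADE-2 TRAP (cell `res-dim4-pi`, K2(p) lane,
# brick «swap normalisation», FILE SN4c)

[OURS · counted 0 · cell `res-dim4-pi` · seat res-dim4-p-7 g3 · desk WORD #116.]  Nothing here proves K2(p), `NoIsolatedTrap p p`, or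
resolution of singularities in dimension ≥ 4 / characteristic `p`.  AI kernel work, weaker than expert review.

**`no_isolated_shadeTwo_trap`**: there is no isolated above-floor `Step0` chain with `x^{r₀} ∣ F₀` and constant shade `2` (any
prime `p`, any field of characteristic `p`).  The assembly `no_isolated_shadeTwo_chain_of` is written against res-dim4-p-11 g3's
SN3 (the unit-class frame through a light step) as an explicit hypothesis `hSN3` and then discharged by their
`SwapTransport.unitFrame_step`.  Assembly: the located residue (`shadeTwo_located`), the free-tail lemma (a satellite step `t`), six
applications of `swapWindow_step` (FILE SN4b) producing the light window `s 0 = c t, …, s 5` with readings (isolation, order,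
ledger) through the relations `ℛ_{π_i}((c (t+i)).F, (s i).F)`, `x^r ∣ F` and `x_f²` carried honestly along the light window
(`IsolatedBand.forall_le_step_of_step0`, `coeff_sq_resForm_step_ne_zero`), the satellite step read as a light SWITCH through the
dictionaries `π_1, π_2`, and PART XII `no_light_switch_window_local`.
bears_on: LADDER-RESOLUTION:D157-DOOR2 (res-dim4-pi · K2(p) · phase d = 2 CLOSED).  Supports
stmt-ResolutionOfSingularities-16155 (helper).
-/

set_option linter.dupNamespace false -- mandated namespace of this single-conjunct summit

noncomputable section

namespace Summit.ResolutionOfSingularities.ResolutionOfSingularities.Theorems.PIDim4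

namespace ResCone

open MvPolynomial Finset
open Literature.AlgebraicGeometry.Resolution
open Literature.AlgebraicGeometry.Resolution.CentreBlowup
open Literature.AlgebraicGeometry.Resolution.Hauser2010
open Literature.AlgebraicGeometry.Resolution.HauserPerlega2019
open SwapNorm

variable {K : Type} [Field K] [DecidableEq K]

variable {p : ℕ} [hp : Fact p.Prime]

/-! ## §1 Facts of a re-presented state read through its dictionary -/

omit [DecidableEq K] hp in
/-- The ledger of a light re-presentation: `|r| = |r^{chain}|`, `r_f = 0`, the other light letters at `1`. [folklore] -/
theorem ledger_of_dictionary {c : ℕ → State K} {j : ℕ → Fin 4} {k : ℕ} {x f : Fin 4} {B : State K}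
    {π : Equiv.Perm (Fin 4)}
    (hloc : (c k).r.degree + 1 = p ∧ (c k).r x + 3 = p ∧ (c k).r (j k) ≤ 1 ∧ (c (k + 1)).r (j k) = 1 ∧
      ∃ f, f ≠ x ∧ (c k).r f = 0 ∧ coeff (Finsupp.single f 2) (resForm (c k)) ≠ 0 ∧ ∀ i, i ≠ x → i ≠ f → (c k).r i = 1)
    (hπx : π x = x) (hπf : (c k).r (π f) = 0) (hBr : ∀ l, B.r l = (c k).r (π l)) (h5 : 5 ≤ p) :
    B.r.degree + 1 = p ∧ B.r f = 0 ∧ (∀ l, l ≠ x → l ≠ f → B.r l = 1) ∧ B.r.degree = (c k).r.degree := by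
  obtain ⟨hW, hx, -, -, fk, -, -, -, hone⟩ := hloc
  have hdeg : B.r.degree = (c k).r.degree := by
    rw [Finsupp.degree_eq_sum, Finsupp.degree_eq_sum]
    calc ∑ l, B.r l = ∑ l, (c k).r (π l) := Finset.sum_congr rfl fun l _ => hBr l
      _ = ∑ l, (c k).r l := Equiv.sum_comp π (fun l => (c k).r l)
  refine ⟨by rw [hdeg]; exact hW, by rw [hBr, hπf], fun l hlx hlf => ?_, hdeg⟩
  rw [hBr]
  have h1 : π l ≠ x := fun h => hlx (π.injective (h.trans hπx.symm))
  have h2 : π l ≠ fk := by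
    intro h
    have hfk : π f = fk := by
      by_contra hne
      have : (c k).r (π f) = 1 := hone _ (fun h' => by rw [h'] at hπf; omega) hne
      omega
    exact hlf (π.injective (h.trans hfk.symm))
  exact hone _ h1 h2

omit hp in
/-- A light step of the window is a `Step0` edge; `x^r ∣ F` and `x_f²` are carried along it. [folklore] -/
theorem lightStep_carries {B B' : State K} {ℓ f : Fin 4} {γ' : K} (hℓf : ℓ ≠ f)
    (hB' : B' = CentreBlowup.step p Finset.univ ℓ (Pi.single f γ' : Fin 4 → K) B)
    (hiso' : IsIsolated p B'.F) (hW : B.r.degree + 1 = p) (hW' : B'.r.degree + 1 = p)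
    (ho : ordZero B.F = ((B.r.degree + 2 : ℕ) : ℕ∞)) (ho' : ordZero B'.F = ((B'.r.degree + 2 : ℕ) : ℕ∞))
    (hr : ∀ e ∈ B.F.support, B.r ≤ e) (hf' : B'.r f = 0) (h5 : 5 ≤ p) :
    (∀ e ∈ B'.F.support, B'.r ≤ e) ∧ coeff (Finsupp.single f 2) (resForm B') ≠ 0 := by
  have hbj : (Pi.single f γ' : Fin 4 → K) ℓ = 0 := Pi.single_eq_of_ne hℓf _
  have hq : (p : ℕ∞) ≤ ordAlong Finset.univ B.F := by
    rw [ordAlong_univ, ho]; exact_mod_cast (show p ≤ B.r.degree + 2 by omega)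
  have hq' : (p : ℕ∞) ≤ ordZero (CentreBlowup.step p Finset.univ ℓ (Pi.single f γ' : Fin 4 → K) B).F := by
    rw [← hB', ho']; exact_mod_cast (show p ≤ B'.r.degree + 2 by omega)
  have hne : (CentreBlowup.step p Finset.univ ℓ (Pi.single f γ' : Fin 4 → K) B).F ≠ 0 := by
    intro h; rw [← hB'] at h; rw [h, ordZero_zero] at ho'; exact ENat.top_ne_coe _ ho'
  have hstep0 : Step0 p B B' :=
    ⟨hq, ℓ, _, Finset.mem_univ _, hbj, (Equimultiple.isEquimultiplePoint_iff_le_ordZero_step p _ ℓ _ B).mpr hq', hne, hB'⟩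
  have hr' : ∀ e ∈ B'.F.support, B'.r ≤ e := IsolatedBand.forall_le_step_of_step0 hstep0 hr
  refine ⟨hr', ?_⟩
  have heq : (CentreBlowup.step p Finset.univ ℓ (Pi.single f γ' : Fin 4 → K) B).shade = B.shade := by
    rw [← hB']
    unfold CState.shade
    rw [ho, ho', ← ENat.coe_sub, ← ENat.coe_sub, Nat.add_sub_cancel_left, Nat.add_sub_cancel_left]
  rw [hB'] at hiso' hr' hW' hf'
  rw [hB']
  exact coeff_sq_resForm_step_ne_zero hbj rfl ho hr (by omega) (by omega) heq hiso' hr' (by omega) hℓf.symm hf'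

/-! ## §2 The d = 2 phase closes, modulo SN3 -/

/-- **NO ISOLATED SHADE-2 TRAP — conditional on SN3.**  Along no witnessed chain do all states stay isolated, above the floor
(`ord₀ F ≠ p`) and of shade `2`, if `x^{r₀} ∣ F₀` — given the unit-class frame step `hSN3` (res-dim4-p-11 g3's SN3, signature of
record 01:59:06Z).  [OURS · K2(p) phase d = 2] [folklore] -/
theorem no_isolated_shadeTwo_chain_of [CharP K p] {c : ℕ → State K} {j : ℕ → Fin 4} {b : ℕ → Fin 4 → K}
    (hSN3 : ∀ (π : Equiv.Perm (Fin 4)) (f : Fin 4) (M : ℕ) (A B : State K) (θ e : Fin 4 → MvPolynomial (Fin 4) K)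
      (G U E : MvPolynomial (Fin 4) K),
      (∀ i, i ≠ f → θ (π i) = X i * e i) → θ (π f) = X f * e f + G → (∀ i, constantCoeff (e i) ≠ 0) →
      constantCoeff G = 0 → coeff (Finsupp.single f 1) G = 0 → constantCoeff U ≠ 0 → E ∈ originIdeal K ^ M →
      B.F = deletePthPowers p (U ^ p * aeval θ A.F) + E →
      (p : ℕ∞) ≤ ordAlong Finset.univ A.F → (p : ℕ∞) ≤ ordAlong Finset.univ B.F →
      ∀ ℓ : Fin 4, ℓ ≠ f → ∀ γ γ' : K, γ * constantCoeff (e ℓ) = coeff (Finsupp.single ℓ 1) G + γ' * constantCoeff (e f) →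
      ∃ (θ' e' : Fin 4 → MvPolynomial (Fin 4) K) (G' U' E' : MvPolynomial (Fin 4) K),
        (∀ i, i ≠ f → θ' (π i) = X i * e' i) ∧ θ' (π f) = X f * e' f + G' ∧ (∀ i, constantCoeff (e' i) ≠ 0) ∧
        constantCoeff G' = 0 ∧ coeff (Finsupp.single f 1) G' = 0 ∧ constantCoeff U' ≠ 0 ∧
        E' ∈ originIdeal K ^ (M - p) ∧
        (CentreBlowup.step p Finset.univ ℓ (Pi.single f γ' : Fin 4 → K) B).F =
          deletePthPowers p (U' ^ p * aeval θ'
            (CentreBlowup.step p Finset.univ (π ℓ) (Pi.single (π f) γ : Fin 4 → K) A).F) + E')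
    (hw : FreeTail.IsWitnessedChain p c j b)
    (hc : ∀ k, IsIsolated p (c k).F ∧ Step0 p (c k) (c (k + 1)) ∧ ordZero (c k).F ≠ p ∧ (c k).shade = 2)
    (hr0 : ∀ e ∈ (c 0).F.support, (c 0).r ≤ e) : False := by
  classical
  obtain ⟨k₁, x, h5, hloc⟩ := shadeTwo_located hw hc hr0
  -- a satellite step beyond `max k₁ 1` (the free-tail lemma)
  obtain ⟨t, ht, hsat⟩ : ∃ t, max k₁ 1 ≤ t ∧ FreeTail.IsSatellite j b t := by
    by_contra h
    push Not at h
    obtain ⟨k, hk⟩ := FreeTailProof.noIsolatedFreeTailAt_self p K c j b (max k₁ 1) hw h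
    exact hk (hc k).1
  have ht1 : ∀ i, k₁ ≤ t + i := fun i => by have := le_max_left k₁ 1; omega
  have ht0 : k₁ ≤ t := by have := le_max_left k₁ 1; omega
  -- the free letter at `t` (= the window's free letter) and the start of the window
  obtain ⟨hWt, hxt, hjt, -, f, hfx, hrft, hsq0, honet⟩ := hloc t ht0
  have hcl0 : deletePthPowers p (c t).F = (c t).F := by
    obtain ⟨t', rfl⟩ : ∃ t', t = t' + 1 := ⟨t - 1, by have := le_max_right k₁ 1; omega⟩
    rw [(hw t').2.2.2.2]; exact FrameChange.deletePthPowers_step_F p _ _ _ _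
  -- isolation certificates of the six chain states and the truncation level
  have hcert : ∀ i, ∃ N, originIdeal K ^ N ≤ singLocusIdeal p (c (t + i)).F ⊔ originIdeal K ^ (N + 1) :=
    fun i => IsolationConverse.exists_certificate_of_isIsolated (hc _).1
  choose Nf hNf using hcert
  set M₀ : ℕ := (∑ i ∈ Finset.range 6, Nf i) + 7 * p + 2 with hM₀
  have hNle : ∀ i, i < 6 → Nf i ≤ ∑ i ∈ Finset.range 6, Nf i := fun i hi =>
    Finset.single_le_sum (fun _ _ => Nat.zero_le _) (Finset.mem_range.mpr hi)
  have hp2 : 2 ≤ p := hp.out.two_le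
  -- stage 0: `B₀ = c t`, `π₀ = 1`
  obtain ⟨θ₀, e₀, G₀, U₀, E₀, h0i, h0f, he₀, hG₀0, hG₀1, hU₀, hE₀, hrel₀⟩ := rel_refl p f M₀ hcl0
  obtain ⟨B₁, π₁, L₀, Γ₀, hB₁, hL₀f, hL₀x, hπ₁L₀, hπ₁x, hπ₁f, hBr₁, -, hdisj₀, ⟨hiso₀, hord₀⟩,
    θ₁, e₁, G₁, U₁, E₁, h1i, h1f, he₁, hG₁0, hG₁1, hU₁, hE₁, hrel₁⟩ :=
    swapWindow_step hSN3 hw hc hr0 h5 hloc ht0 (f := f) (B := c t) (π := 1)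
      (Equiv.Perm.one_apply x) hrft (fun l => rfl) h0i h0f he₀ hG₀0 hG₀1 hU₀ hE₀ hrel₀ (hNf 0)
      (by have := hNle 0 (by norm_num); omega) (by omega)
  -- stage 1
  obtain ⟨B₂, π₂, L₁, Γ₁, hB₂, hL₁f, hL₁x, hπ₂L₁, hπ₂x, hπ₂f, hBr₂, -, hdisj₁, ⟨hiso₁, hord₁⟩,
    θ₂, e₂, G₂, U₂, E₂, h2i, h2f, he₂, hG₂0, hG₂1, hU₂, hE₂, hrel₂⟩ :=
    swapWindow_step hSN3 hw hc hr0 h5 hloc (ht1 1) hπ₁x hπ₁f hBr₁ h1i h1f he₁ hG₁0 hG₁1 hU₁ hE₁ hrel₁ (hNf 1)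
      (by have := hNle 1 (by norm_num); omega) (by omega)
  -- stage 2
  obtain ⟨B₃, π₃, L₂, Γ₂, hB₃, hL₂f, hL₂x, hπ₃L₂, hπ₃x, hπ₃f, hBr₃, -, -, ⟨hiso₂, hord₂⟩,
    θ₃, e₃, G₃, U₃, E₃, h3i, h3f, he₃, hG₃0, hG₃1, hU₃, hE₃, hrel₃⟩ :=
    swapWindow_step hSN3 hw hc hr0 h5 hloc (ht1 2) hπ₂x hπ₂f hBr₂ h2i h2f he₂ hG₂0 hG₂1 hU₂ hE₂ hrel₂ (hNf 2)
      (by have := hNle 2 (by norm_num); omega) (by omega)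
  -- stage 3
  obtain ⟨B₄, π₄, L₃, Γ₃, hB₄, hL₃f, hL₃x, hπ₄L₃, hπ₄x, hπ₄f, hBr₄, -, -, ⟨hiso₃, hord₃⟩,
    θ₄, e₄, G₄, U₄, E₄, h4i, h4f, he₄, hG₄0, hG₄1, hU₄, hE₄, hrel₄⟩ :=
    swapWindow_step hSN3 hw hc hr0 h5 hloc (ht1 3) hπ₃x hπ₃f hBr₃ h3i h3f he₃ hG₃0 hG₃1 hU₃ hE₃ hrel₃ (hNf 3)
      (by have := hNle 3 (by norm_num); omega) (by omega)
  -- stage 4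
  obtain ⟨B₅, π₅, L₄, Γ₄, hB₅, hL₄f, hL₄x, hπ₅L₄, hπ₅x, hπ₅f, hBr₅, -, -, ⟨hiso₄, hord₄⟩,
    θ₅, e₅, G₅, U₅, E₅, h5i, h5f, he₅, hG₅0, hG₅1, hU₅, hE₅, hrel₅⟩ :=
    swapWindow_step hSN3 hw hc hr0 h5 hloc (ht1 4) hπ₄x hπ₄f hBr₄ h4i h4f he₄ hG₄0 hG₄1 hU₄ hE₄ hrel₄ (hNf 4)
      (by have := hNle 4 (by norm_num); omega) (by omega)
  -- stage 5 (readings of `B₅` only)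
  obtain ⟨-, -, -, -, -, -, -, -, -, -, -, -, -, ⟨hiso₅, hord₅⟩, -⟩ :=
    swapWindow_step hSN3 hw hc hr0 h5 hloc (ht1 5) hπ₅x hπ₅f hBr₅ h5i h5f he₅ hG₅0 hG₅1 hU₅ hE₅ hrel₅ (hNf 5)
      (by have := hNle 5 (by norm_num); omega) (by omega)
  -- ledgers
  obtain ⟨hW0, hrf0, hone0, hdeg0⟩ := ledger_of_dictionary (B := c t) (π := (1 : Equiv.Perm (Fin 4)))
    (hloc t ht0) (Equiv.Perm.one_apply x) hrft (fun l => rfl) h5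
  obtain ⟨hW1, hrf1, hone1, hdeg1⟩ := ledger_of_dictionary (hloc _ (ht1 1)) hπ₁x hπ₁f hBr₁ h5
  obtain ⟨hW2, hrf2, hone2, hdeg2⟩ := ledger_of_dictionary (hloc _ (ht1 2)) hπ₂x hπ₂f hBr₂ h5
  obtain ⟨hW3, hrf3, hone3, hdeg3⟩ := ledger_of_dictionary (hloc _ (ht1 3)) hπ₃x hπ₃f hBr₃ h5
  obtain ⟨hW4, hrf4, hone4, hdeg4⟩ := ledger_of_dictionary (hloc _ (ht1 4)) hπ₄x hπ₄f hBr₄ h5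
  obtain ⟨hW5, hrf5, hone5, hdeg5⟩ := ledger_of_dictionary (hloc _ (ht1 5)) hπ₅x hπ₅f hBr₅ h5
  rw [← hdeg0] at hord₀; rw [← hdeg1] at hord₁; rw [← hdeg2] at hord₂; rw [← hdeg3] at hord₃
  rw [← hdeg4] at hord₄; rw [← hdeg5] at hord₅
  -- `x^r ∣ F` and `x_f²` along the light window
  have hr_0 : ∀ e ∈ (c t).F.support, (c t).r ≤ e := (chain_step hw hc hr0 t).2.2.2.1
  obtain ⟨hr_1, hsq1⟩ := lightStep_carries hL₀f hB₁ hiso₁ hW0 hW1 hord₀ hord₁ hr_0 hrf1 h5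
  obtain ⟨hr_2, hsq2⟩ := lightStep_carries hL₁f hB₂ hiso₂ hW1 hW2 hord₁ hord₂ hr_1 hrf2 h5
  obtain ⟨hr_3, hsq3⟩ := lightStep_carries hL₂f hB₃ hiso₃ hW2 hW3 hord₂ hord₃ hr_2 hrf3 h5
  obtain ⟨hr_4, hsq4⟩ := lightStep_carries hL₃f hB₄ hiso₄ hW3 hW4 hord₃ hord₄ hr_3 hrf4 h5
  obtain ⟨hr_5, -⟩ := lightStep_carries hL₄f hB₅ hiso₅ hW4 hW5 hord₄ hord₅ hr_4 hrf5 h5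
  -- the satellite step `t` is a light SWITCH: `L 1 ≠ L 0`
  have huv : L₀ ≠ L₁ := by
    intro hLL
    rcases hdisj₁ with ⟨hπeq, -⟩ | ⟨a, hba, haf, hja, hπeq⟩
    · apply hsat.1
      rw [← hπ₂L₁, hπeq, ← hLL, hπ₁L₀]
    · have h1 : π₂ L₀ = j t := by
        rw [hπeq, Equiv.trans_apply, hπ₁L₀, Equiv.swap_apply_of_ne_of_ne]
        · intro h; rw [← h] at hba; exact hba hsat.2
        · rw [← hja]; exact hsat.1.symm
      apply hsat.1
      rw [← hπ₂L₁, ← hLL, h1]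
  -- the window
  let s : ℕ → State K := fun i =>
    match i with | 0 => c t | 1 => B₁ | 2 => B₂ | 3 => B₃ | 4 => B₄ | _ => B₅
  let L : ℕ → Fin 4 := fun i => match i with | 0 => L₀ | 1 => L₁ | 2 => L₂ | 3 => L₃ | _ => L₄
  let Γ : ℕ → K := fun i => match i with | 0 => Γ₀ | 1 => Γ₁ | 2 => Γ₂ | 3 => Γ₃ | _ => Γ₄
  have hLuv : ∀ i, i ≤ 4 → L i = L₀ ∨ L i = L₁ := by
    have key : ∀ l : Fin 4, l ≠ f → l ≠ x → l = L₀ ∨ l = L₁ := by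
      intro l hlf hlx
      by_cases h : l = L₀
      · exact Or.inl h
      · exact Or.inr (fin4_eq_of_forall_ne hfx hL₀f.symm hL₀x.symm ⟨hlf, hlx, h⟩ ⟨hL₁f, hL₁x, fun h' => huv h'.symm⟩)
    intro i hi
    interval_cases i
    · exact Or.inl rfl
    · exact Or.inr rfl
    · exact key L₂ hL₂f hL₂x
    · exact key L₃ hL₃f hL₃x
    · exact key L₄ hL₄f hL₄x
  refine no_light_switch_window_local (s := s) (j := L) (β := fun i => (Pi.single f (Γ i) : Fin 4 → K)) h5 huv
    hL₀f hL₁f ?_ hcl0 ?_ ?_ (hone1 L₁ hL₁x hL₁f) (hone2 L₀ hL₀x hL₀f) rfl rfl (hLuv 2 (by norm_num))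
    (hLuv 3 (by norm_num)) (hLuv 4 (by norm_num))
  · intro i hi
    interval_cases i
    · exact ⟨(hc _).1, hr_0, hord₀, hW0, hrf0⟩
    · exact ⟨hiso₁, hr_1, hord₁, hW1, hrf1⟩
    · exact ⟨hiso₂, hr_2, hord₂, hW2, hrf2⟩
    · exact ⟨hiso₃, hr_3, hord₃, hW3, hrf3⟩
    · exact ⟨hiso₄, hr_4, hord₄, hW4, hrf4⟩
    · exact ⟨hiso₅, hr_5, hord₅, hW5, hrf5⟩
  · intro i hi
    interval_cases i
    · exact ⟨hB₁, Pi.single_eq_of_ne hL₀f _, fun i' hi' => Pi.single_eq_of_ne hi' _⟩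
    · exact ⟨hB₂, Pi.single_eq_of_ne hL₁f _, fun i' hi' => Pi.single_eq_of_ne hi' _⟩
    · exact ⟨hB₃, Pi.single_eq_of_ne hL₂f _, fun i' hi' => Pi.single_eq_of_ne hi' _⟩
    · exact ⟨hB₄, Pi.single_eq_of_ne hL₃f _, fun i' hi' => Pi.single_eq_of_ne hi' _⟩
    · exact ⟨hB₅, Pi.single_eq_of_ne hL₄f _, fun i' hi' => Pi.single_eq_of_ne hi' _⟩
  · intro i hi
    interval_cases i
    · exact hsq0
    · exact hsq1
    · exact hsq2
    · exact hsq3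
    · exact hsq4

/-- **NO ISOLATED SHADE-2 TRAP (item (3) of the d = 2 phase), conditional on SN3**: there is no isolated above-floor `Step0`
chain with `x^{r₀} ∣ F₀` and constant shade `2`. [OURS · K2(p) phase d = 2] [folklore] -/
theorem no_isolated_shadeTwo_trap_of [CharP K p]
    (hSN3 : ∀ (π : Equiv.Perm (Fin 4)) (f : Fin 4) (M : ℕ) (A B : State K) (θ e : Fin 4 → MvPolynomial (Fin 4) K)
      (G U E : MvPolynomial (Fin 4) K),
      (∀ i, i ≠ f → θ (π i) = X i * e i) → θ (π f) = X f * e f + G → (∀ i, constantCoeff (e i) ≠ 0) →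
      constantCoeff G = 0 → coeff (Finsupp.single f 1) G = 0 → constantCoeff U ≠ 0 → E ∈ originIdeal K ^ M →
      B.F = deletePthPowers p (U ^ p * aeval θ A.F) + E →
      (p : ℕ∞) ≤ ordAlong Finset.univ A.F → (p : ℕ∞) ≤ ordAlong Finset.univ B.F →
      ∀ ℓ : Fin 4, ℓ ≠ f → ∀ γ γ' : K, γ * constantCoeff (e ℓ) = coeff (Finsupp.single ℓ 1) G + γ' * constantCoeff (e f) →
      ∃ (θ' e' : Fin 4 → MvPolynomial (Fin 4) K) (G' U' E' : MvPolynomial (Fin 4) K),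
        (∀ i, i ≠ f → θ' (π i) = X i * e' i) ∧ θ' (π f) = X f * e' f + G' ∧ (∀ i, constantCoeff (e' i) ≠ 0) ∧
        constantCoeff G' = 0 ∧ coeff (Finsupp.single f 1) G' = 0 ∧ constantCoeff U' ≠ 0 ∧
        E' ∈ originIdeal K ^ (M - p) ∧
        (CentreBlowup.step p Finset.univ ℓ (Pi.single f γ' : Fin 4 → K) B).F =
          deletePthPowers p (U' ^ p * aeval θ'
            (CentreBlowup.step p Finset.univ (π ℓ) (Pi.single (π f) γ : Fin 4 → K) A).F) + E') :
    ¬ ∃ c : ℕ → State K, (∀ e ∈ (c 0).F.support, (c 0).r ≤ e) ∧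
      ∀ k, IsIsolated p (c k).F ∧ Step0 p (c k) (c (k + 1)) ∧ ordZero (c k).F ≠ p ∧ (c k).shade = 2 := by
  rintro ⟨c, hr0, hc⟩
  obtain ⟨j, b, hw⟩ := FreeTail.exists_witnesses fun k => (hc k).2.1
  exact no_isolated_shadeTwo_chain_of hSN3 hw hc hr0

/-! ## §3 The discharge: SN3 is res-dim4-p-11 g3's `SwapTransport.unitFrame_step` -/

/-- **NO ISOLATED SHADE-2 CHAIN** (unconditional): along no witnessed chain over a field of characteristic `p` do all states stay
isolated, above the floor and of shade `2`, if `x^{r₀} ∣ F₀`. [OURS · K2(p) phase d = 2] [folklore] -/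
theorem no_isolated_shadeTwo_chain [CharP K p] {c : ℕ → State K} {j : ℕ → Fin 4} {b : ℕ → Fin 4 → K}
    (hw : FreeTail.IsWitnessedChain p c j b)
    (hc : ∀ k, IsIsolated p (c k).F ∧ Step0 p (c k) (c (k + 1)) ∧ ordZero (c k).F ≠ p ∧ (c k).shade = 2)
    (hr0 : ∀ e ∈ (c 0).F.support, (c 0).r ≤ e) : False :=
  no_isolated_shadeTwo_chain_of
    (fun π f _ _ _ _ _ _ _ _ hθi hθf he hG0 hG1 hU hE hrel hA hB _ hℓf _ _ hγ =>
      SwapTransport.unitFrame_step p π f hθi hθf he hG0 hG1 hU hE hrel hA hB hℓf hγ)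
    hw hc hr0

/-- **NO ISOLATED SHADE-2 TRAP — item (3) of the `d = 2` phase of the located residue of K2(p), every prime, every field of
characteristic `p`**: there is no isolated above-floor `Step0` chain with `x^{r₀} ∣ F₀` and constant shade `2`.
[OURS · K2(p) phase d = 2] [folklore] -/
theorem no_isolated_shadeTwo_trap (p : ℕ) [Fact p.Prime] (K : Type) [Field K] [CharP K p] [DecidableEq K] :
    ¬ ∃ c : ℕ → State K, (∀ e ∈ (c 0).F.support, (c 0).r ≤ e) ∧
      ∀ k, IsIsolated p (c k).F ∧ Step0 p (c k) (c (k + 1)) ∧ ordZero (c k).F ≠ p ∧ (c k).shade = 2 := by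
  rintro ⟨c, hr0, hc⟩
  obtain ⟨j, b, hw⟩ := FreeTail.exists_witnesses fun k => (hc k).2.1
  exact no_isolated_shadeTwo_chain hw hc hr0

end ResCone

end Summit.ResolutionOfSingularities.ResolutionOfSingularities.Theorems.PIDim4

end
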